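import Summits.BirchSwinnertonDyer.BirchSwinnertonDyer.Theorems.KimAtThreeDeepLowerExpStarOmegaLine
import Literature.NumberTheory.GaloisRepresentations.AbsGaloisGroupProofs
import HarnessLib

/-!
# A Néron line of `V_pW` along a TOWER restriction `Γ_L → Γ_{K₁} → Γ_ℚ` (the `hdimL` input of (RES) at the
# factor fields `L_w ⊇ ℚ_v`) from `PAdicHodge.nonempty_neronDeRhamDatum` BY NAME
# (route `KimAtThreeKolyvagin`, rung W2; cell `bsd-addord`, seat w2-c2 gen 8; sequel of `…ExpStarOmegaLine`)

HONEST FRAMING. Theorems only (no definition, no named fact, no `sorry`, no instance); nothing is closed or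
booked; BSD is not proved by any of this.

`KimAtThreeDeepLowerExpStarOmegaLine` supplies a Néron line of `V_pW|_{res_{L/ℚ}}` for the DIRECT restriction
`absGaloisRestrict ℚ L`.  The semi-local consumers (seat kim3's hKdef at the factor fields `L_w` of `ℚ(ζ_m) ⊗ ℚ₃`, and
this seat's (RES) theorem `exists_localNeronLine_expStarOmega_res` with its input `hdimL`) restrict along the
TOWER `res_{ℚ_v/ℚ} ∘ res_{L/ℚ_v}`, which agrees with the direct restriction only up to an inner automorphism of
`Γ_ℚ` (the two choices of `ℚ̄ → L̄` differ by an element of `Γ_ℚ`; the tree's PROVED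
`absGaloisRestrict_isConj_of_algHom_holds`, Milne FT §7).  Conjugate restrictions give isomorphic
representations (`ρ(τ)` intertwines), and the scale-free line datum transports (`FilZeroLine.map`).

* `exists_conj_absGaloisRestrict_comp` — `∃ τ ∈ Γ_ℚ, ∀ σ, res_{K₁/ℚ}(res_{L/K₁} σ) = τ · res_{L/ℚ} σ · τ⁻¹`.
* `nonempty_localNeronLine_comp_of_nonempty` — a line along `absGaloisRestrict ℚ L` gives one along the tower.
* ★ `nonempty_localNeronLine_comp_of_nonempty_neronDeRhamDatum` — **a Néron line along the tower at every `p`-adic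
  `L ⊇ K₁ ⊇ ℚ`** from `nonempty_neronDeRhamDatum` BY NAME.

References: J. S. Milne, *Fields and Galois Theory*, §7 [MilneFT2022]; K. Kato, LNM 1553 (1993), Ch. II Ex. 1.3.5
[Kato1993LNM1553]; J.-P. Serre, *Abelian ℓ-adic representations* (1968), I §1.2 [Serre1968].
-/

set_option autoImplicit false
-- the Theorems namespace of a single-conjunct summit repeats the summit name by design (D-0017)
set_option linter.dupNamespace false

noncomputable section

open scoped TensorProduct
open Field ValuativeRel Function
open Literature.NumberTheory.GaloisRepresentations
open Literature.NumberTheory.GaloisRepresentations.PeriodRingData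
open Literature.NumberTheory.PAdicHodge
open Literature.NumberTheory.EllipticCurves
open Summit.BirchSwinnertonDyer.BirchSwinnertonDyer.Theorems.KimAtThreeDeepLowerExpStarOmega
open Summit.BirchSwinnertonDyer.BirchSwinnertonDyer.Theorems.KimAtThreeDeepLowerExpStarOmegaLine

namespace Summit.BirchSwinnertonDyer.BirchSwinnertonDyer.Theorems.KimAtThreeDeepLowerExpStarOmegaTower

/-! ### The tower restriction is conjugate to the direct one -/

section Conj

variable (K₁ L : Type) [Field K₁] [Field L] [Algebra ℚ K₁] [Algebra K₁ L] [Algebra ℚ L]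

/-- **`res_{K₁/ℚ} ∘ res_{L/K₁}` is conjugate to `res_{L/ℚ}` in `Γ_ℚ`**: both restrict along `ℚ`-embeddings
`ℚ̄ → L̄` (the composite of the chosen `ℚ̄ → K̄₁ → L̄`, resp. the chosen `ℚ̄ → L̄`), which differ by an element of
`Γ_ℚ` (the tree's `absGaloisRestrict_isConj_of_algHom_holds`). [cite: MilneFT2022, Ch. 7 (the absolute Galois group is defined up to an inner automorphism)] -/
theorem exists_conj_absGaloisRestrict_comp :
    ∃ τ : absoluteGaloisGroup ℚ, ∀ σ : absoluteGaloisGroup L,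
      absGaloisRestrict ℚ K₁ (absGaloisRestrict K₁ L σ) = τ * absGaloisRestrict ℚ L σ * τ⁻¹ := by
  -- the composite embedding `ℚ̄ → K̄₁ → L̄` (a ring homomorphism; `ℚ`-linear since every ring map is)
  let f : AlgebraicClosure ℚ →+* AlgebraicClosure L :=
    (absClosureEmbedding K₁ L).toRingHom.comp (absClosureEmbedding ℚ K₁).toRingHom
  have hf : ∀ (σ : absoluteGaloisGroup L) (x : AlgebraicClosure ℚ),
      f (absGaloisRestrict ℚ K₁ (absGaloisRestrict K₁ L σ) • x) = σ • f x := fun σ x => by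
    change absClosureEmbedding K₁ L (absClosureEmbedding ℚ K₁ _) =
      σ • absClosureEmbedding K₁ L (absClosureEmbedding ℚ K₁ x)
    rw [absGaloisRestrict_apply_smul, absGaloisRestrict_apply_smul]
  refine absGaloisRestrict_isConj_of_algHom_holds ℚ L ⟨f, fun q => ?_⟩ _ hf
  change f (algebraMap ℚ (AlgebraicClosure ℚ) q) = algebraMap ℚ (AlgebraicClosure L) q
  haveI : CharZero L := charZero_of_injective_algebraMap (algebraMap ℚ L).injective
  rw [eq_ratCast (algebraMap ℚ (AlgebraicClosure ℚ)), map_ratCast]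
  exact (eq_ratCast _ q).symm

end Conj

/-! ### Transport of the Néron line along the conjugation -/

section Tower

variable {L : Type} [Field L] [ValuativeRel L] [TopologicalSpace L] [IsNonarchimedeanLocalField L] [CharZero L]
  (W : WeierstrassCurve ℚ) [W.IsElliptic] {p : ℕ} [Fact p.Prime]
  [Fact (¬ IsUnit (p : integerC L))] [IsAdicComplete (Ideal.span {(p : integerC L)}) (integerC L)]
  (hL : valuation L p < 1) [Algebra ℚ_[p] L] [Algebra ℚ L]
  (K₁ : Type) [Field K₁] [Algebra ℚ K₁] [Algebra K₁ L]

/-- **A Néron line along `res_{L/ℚ}` gives one along the tower `res_{K₁/ℚ} ∘ res_{L/K₁}`**: with `τ` as in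
`exists_conj_absGaloisRestrict_comp`, `ρ_W(τ)` is an isomorphism of `Γ_L`-representations from `V_pW|_{res_{L/ℚ}}`
to `V_pW|_{tower}`, and the scale-free datum transports (`FilZeroLine.map`). [cite: Kato1993LNM1553, Ch. II Ex. 1.3.5]
[cite: MilneFT2022, Ch. 7] -/
theorem nonempty_localNeronLine_comp_of_nonempty (h : Nonempty (LocalNeronLine W hL (absGaloisRestrict ℚ L))) :
    Nonempty (LocalNeronLine W hL ((absGaloisRestrict ℚ K₁).comp (absGaloisRestrict K₁ L))) := by
  obtain ⟨d⟩ := h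
  obtain ⟨τ, hτ⟩ := exists_conj_absGaloisRestrict_comp K₁ L
  -- `ρ_W(τ)` as a linear automorphism of `V_pW`
  let ρ := W.rationalGaloisRepTate p
  let φ : W.rationalTateModule p ≃ₗ[ℚ_[p]] W.rationalTateModule p :=
    LinearEquiv.ofLinear (ρ τ) (ρ τ⁻¹)
      (by rw [← Module.End.mul_eq_comp, ← map_mul, mul_inv_cancel, map_one, Module.End.one_eq_id])
      (by rw [← Module.End.mul_eq_comp, ← map_mul, inv_mul_cancel, map_one, Module.End.one_eq_id])
  refine ⟨d.map φ fun σ m => ?_⟩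
  change ρ τ (ρ (absGaloisRestrict ℚ L σ) m) =
    ρ (absGaloisRestrict ℚ K₁ (absGaloisRestrict K₁ L σ)) (ρ τ m)
  rw [hτ, ← Module.End.mul_apply, ← map_mul, ← Module.End.mul_apply, ← map_mul, inv_mul_cancel_right]

/-- ★ **A Néron line along the tower `Γ_L → Γ_{K₁} → Γ_ℚ` exists at every `p`-adic field `L ⊇ K₁ ⊇ ℚ`, from
`PAdicHodge.nonempty_neronDeRhamDatum` BY NAME** (direct line by `…ExpStarOmegaLine` §1 + the Néron de Rham datum of
`W ×_ℚ L`, then the conjugation transport).  This is the input `hdimL` of (RES)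
(`KimAtThreeDeepLowerExpStarOmegaRes.exists_localNeronLine_expStarOmega_res`) at `K = ℚ_v`, `L = L_w`.
[cite: Kato1993LNM1553, Ch. II Ex. 1.3.5] -/
theorem nonempty_localNeronLine_comp_of_nonempty_neronDeRhamDatum (hND : nonempty_neronDeRhamDatum) :
    Nonempty (LocalNeronLine W hL ((absGaloisRestrict ℚ K₁).comp (absGaloisRestrict K₁ L))) := by
  refine nonempty_localNeronLine_comp_of_nonempty W hL K₁ ?_
  obtain ⟨E, hE⟩ := exists_rationalTateModule_equiv_baseChange_of_injective W L p
  obtain ⟨d'⟩ := hND hL (W.baseChange L)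
  refine ⟨d'.map E.symm fun σ m => ?_⟩
  apply E.injective
  rw [LinearEquiv.apply_symm_apply]
  change (W.baseChange L).rationalGaloisRepTate p σ m = E (W.rationalGaloisRepTate p (absGaloisRestrict ℚ L σ) (E.symm m))
  rw [hE, LinearEquiv.apply_symm_apply]

end Tower

end Summit.BirchSwinnertonDyer.BirchSwinnertonDyer.Theorems.KimAtThreeDeepLowerExpStarOmegaTower

end
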